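import Literature.NumberTheory.EllipticCurves.FineSelmerReducibleIsotypicMuRoad
import Literature.NumberTheory.EllipticCurves.FineSelmerClassGroupCriterionTorsionPointFieldEigen
import Literature.NumberTheory.NumberFields.EquivariantIwasawaLemmaTotallyRamified
import Literature.NumberTheory.IwasawaTheory.EquivariantHomLayerOfAbsolute
import HarnessLib

/-!
# Coates–Sujatha's Conjecture A on a REDUCIBLE row from LAYER-ZERO data: door L6 («no `χ_i`-isotypic class up the
# cyclotomic tower») for EACH of the two characters `χ₁` (on `C`) and `χ₂` (on `E[p]/C`), glued to the isotypic road
# (proved; no definition, no named fact, no `sorry`)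

`Proofs`-style file (theorems only) in topic `NumberTheory/EllipticCurves` (namespace
`Literature.NumberTheory.EllipticCurves.CoatesSujatha2005`, grouping sub-namespace `ReducibleLayerZero` for the two
per-character count lemmas), written by the prover seat `bsd-potss-rkm` g39 (cell `bsd-potss`; item
stmt-BirchSwinnertonDyer-19196 `ReducibleKatoMember`, `--supports`; closes nothing; neither Conjecture A nor BSD is proved for
any particular curve here — the per-row layer-zero data remain hypotheses).

SETTING.  `E = W/ℚ` elliptic, `p` odd, `C ≤ E[p]` a `Γ_ℚ`-stable LINE (`C ≠ 0, E[p]`), `χ₁` the character of `C`, `χ₂` that of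
`E[p]/C`, `F = ℚ(χ₁, χ₂) = ℚ̄^{borelKernel C}` the Borel field (`[F : ℚ] ∣ (p − 1)²`), `κ` the cyclotomic `ℤ_p`-extension,
`F_n = F·ℚ_n = ℚ̄^{borelKernel C ∩ κ⁻¹(pⁿℤ_p)}`.

§1 (`fineSelmerInfty_torsion_finite_of_reducible_of_natCard_le`, any number field `K`) — the COUNT FORM of the isotypic road of
`FineSelmerReducibleIsotypicMuRoad` (rkm g38): `Sel₀(K_∞, E[p])` is finite as soon as, for `V = C` AND for `V = E[p]/C`, the
additive maps `Cl(𝓞_{F_n}) → V` equivariant under `Gal(K̄/K_n)` are bounded in number uniformly in `n` (g38 fed these bounds from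
bounded `p`-ranks of `K(χ_i)·K_n`; here they are abstract hypotheses, spelled instance-free through `E[p]` and `E[p] → E[p]/C`).

§2 (`ReducibleLayerZero.natCard_equivariantHom_line_layer_le_one`, `…_quotient_layer_le_one`, over `ℚ`) — DOOR L6 PER CHARACTER:
for `V = C` (resp. `V = E[p]/C`) the `Gal(ℚ̄/ℚ_n)`-equivariant maps `Cl(𝓞_{F_n}) → V` number `≤ 1` at EVERY `n` as soon as
(c2*)ᵢ every TAUTOLOGICAL EIGENFUNCTIONAL on the class group of a subfield `Kᵢ ⊆ F` fixing a generator `Pᵢ` of `V` vanishes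
(«`μ([σ̄I]) = a·μ([I])` whenever `τ|_{Kᵢ} = σ̄` and `τ•Pᵢ ≡ a•Pᵢ`»: no `χᵢ`-eigenline of `Aut(Kᵢ/ℚ)` in `Cl(Kᵢ) ⊗ 𝔽_p`; per row
`Kᵢ = ℚ(P)` resp. `ℚ(P′)`, cyclic of degree `∣ p − 1`) and (c3*)ᵢ `V^{D_p} = 0` (`χᵢ ≠ 1` on the decomposition group at `p`,
i.e. `p` not totally split in `ℚ(χᵢ)`).  Proof: conjA-anchor g13's eigen-test
(`DeoRaySujatha2023.equivariantHom_classGroup_eq_zero_of_eigenHom_subfield`, `S = ∅`, the irreducibility hypothesis being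
trivial for the one-dimensional `V`) gives (c2*) at `F`; conjA-anchor g16's door L6
(`EquivariantIwasawaLemma.equivariantHom_classGroup_eq_zero_layer_compositum_tower_of_totallyRamified`, `ℚ_∞/ℚ` totally
ramified at `p`) propagates the `Γ_ℚ`-equivariant vanishing to every `F·ℚ_n`; the `p`-group fixed-point bridge
(`EquivariantHomLayerOfAbsolute`, rkm g39) turns it into `Gal(ℚ̄/ℚ_n)`-equivariant vanishing; `F·ℚ_n = ℚ̄^{N ∩ κ⁻¹(pⁿℤ_p)}`
(`FineSelmerStabilizerDescent.fixedField_inf_layerSubgroup_eq_fixedField_sup_layer`).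

§3 (`conjA_of_reducible_of_layerZero_or_classGroupPRank_le`, over `ℚ`) — statement (A) for `E` at `p` when EACH side `i ∈ {1,2}`
passes EITHER its layer-zero door (c2*)ᵢ + (c3*)ᵢ OR g38's bounded-`p`-rank door along a cyclotomic `ℤ_p`-extension of `ℚ(χᵢ)`
(classical `μ = 0` of `ℚ(χᵢ)`); `conjA_of_reducible_of_eigenHom_subfields` is the pure layer-zero case.  On the cell's K8-t′ X3
reducible rows the layer-zero door holds on both sides for every row at `p ∈ {7, 11, 17}` and for 407/591 rows at `p = 5`
(kit census of the seat, evidence on the item).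

References: [CoatesSujatha2005] §3 Thm. 3.4, Lemma 3.8, Cor. 3.6; [DeoRaySujatha2023] §3 Thm. 3.8 (c2), (c3), §5 Lemma 5.1;
[Washington1997] §10.1 Thm. 10.4 (proof), §13.1, §13.3 Lemmas 13.14–13.16; [Wuthrich2014] Lemma 14; [Lim2017FineSelmer] §3
(isotypic reading); [LimSujatha2018] §3.
-/

set_option autoImplicit false

noncomputable section

open scoped Classical Pointwise NumberField nonZeroDivisors
open NumberField IsDedekindDomain Field IntermediateField

namespace Literature.NumberTheory.EllipticCurves.CoatesSujatha2005

open Literature.NumberTheory.IwasawaTheory Literature.NumberTheory.GaloisRepresentations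
  Literature.NumberTheory.NumberFields Literature.NumberTheory.EllipticCurves
  Literature.NumberTheory.EllipticCurves.GreenbergSelmer Literature.NumberTheory.EllipticCurves.ZpExtension
  Literature.NumberTheory.IwasawaTheory.EquivariantUnramifiedHomsZpTowerFinite
  Literature.NumberTheory.IwasawaTheory.EquivariantHomLayerOfAbsolute
  Literature.NumberTheory.EllipticCurves.FineSelmerReducibleIsotypic
  Literature.NumberTheory.EllipticCurves.FineSelmerDevissage
-- `_root_`: some import closures declare `Literature.NumberTheory.EllipticCurves.WeierstrassCurve.*`
open _root_.WeierstrassCurve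

/-! ## §1 The count form of the isotypic road (any number field) -/

section Count

variable {K : Type} [Field K] [NumberField K] (W : WeierstrassCurve K) [W.IsElliptic] {p : ℕ} [Fact p.Prime]

/-- **`Sel₀(K_∞, E[p])` is finite on a reducible row from BOUNDED EQUIVARIANT COUNTS for the two characters.**  `E = W`
elliptic over the number field `K`, `p` odd, `κ` the cyclotomic `ℤ_p`-extension, `C ≤ E[p]` a `Γ_K`-stable subgroup (a line in the application),
`N = borelKernel C`, `F_n = K̄^{N ∩ κ⁻¹(pⁿℤ_p)} = K(χ₁,χ₂)·K_n`.  If for every `n` the additive maps `μ : Cl(𝓞_{F_n}) → C` with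
`μ(γ|·c) = γ • μ(c)` for `γ ∈ Gal(K̄/K_n)` number at most `B₁`, and the additive maps `μ : Cl(𝓞_{F_n}) → E[p]/C` with
`μ(γ|·c) = γ • m mod C` whenever `μ(c) = m mod C` number at most `B₂`, then `Sel₀(K_∞, E[p])` is finite (equivariant dévissage
`FineSelmerDevissage.finite_fineSelmerInfty_of_extension_equivariant` + the equivariant class-field-theoretic count
`equivariantUnramifiedHoms_finite_of_card_le` for `V = E[p]/C` and `V = C`).
[cite: CoatesSujatha2005, §3 Lemma 3.8, Thm. 3.4 and Cor. 3.6] [cite: Wuthrich2014, Lemma 14 (p. 396)]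
[cite: Lim2017FineSelmer, §3 (isotypic reading)] [cite: SilvermanAEC2009, Prop. VII.4.1 (a)] -/
theorem fineSelmerInfty_torsion_finite_of_reducible_of_natCard_le (hp : p ≠ 2)
    (κ : ZpExtension K p) (hκ : κ.IsCyclotomic)
    (C : AddSubgroup (W.geomTorsion (p : ℤ)))
    (hC : ∀ (σ : absoluteGaloisGroup K) (x : W.geomTorsion (p : ℤ)), x ∈ C → σ • x ∈ C)
    (B₁ B₂ : ℕ)
    (hcntC : ∀ n : ℕ,
      haveI : (W.borelKernel C).Normal := borelKernel_normal hC
      haveI : IsGalois K (fixedField (W.borelKernel C ⊓ κ.layerSubgroup n) : IntermediateField K (AlgebraicClosure K)) :=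
        isGalois_fixedField_inf_layerSubgroup κ (W.borelKernel C) (isOpen_borelKernel C) n
      Nat.card {μ : Additive (ClassGroup (𝓞 (fixedField (W.borelKernel C ⊓ κ.layerSubgroup n) :
          IntermediateField K (AlgebraicClosure K)))) →+ C //
        ∀ γ ∈ κ.layerSubgroup n, ∀ c,
          ((μ (Additive.ofMul (ClassGroup.mulEquiv (AmbiguousClass.intAut
            (absRestrictNormalHom (fixedField (W.borelKernel C ⊓ κ.layerSubgroup n) :
              IntermediateField K (AlgebraicClosure K)) γ)) c)) : C) : W.geomTorsion (p : ℤ)) =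
            γ • ((μ (Additive.ofMul c) : C) : W.geomTorsion (p : ℤ))} ≤ B₁)
    (hcntQ : ∀ n : ℕ,
      haveI : (W.borelKernel C).Normal := borelKernel_normal hC
      haveI : IsGalois K (fixedField (W.borelKernel C ⊓ κ.layerSubgroup n) : IntermediateField K (AlgebraicClosure K)) :=
        isGalois_fixedField_inf_layerSubgroup κ (W.borelKernel C) (isOpen_borelKernel C) n
      Nat.card {μ : Additive (ClassGroup (𝓞 (fixedField (W.borelKernel C ⊓ κ.layerSubgroup n) :
          IntermediateField K (AlgebraicClosure K)))) →+ (↥(W.geomTorsion (p : ℤ)) ⧸ C) //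
        ∀ γ ∈ κ.layerSubgroup n, ∀ c, ∀ m : W.geomTorsion (p : ℤ), μ (Additive.ofMul c) = (m : ↥(W.geomTorsion (p : ℤ)) ⧸ C) →
          μ (Additive.ofMul (ClassGroup.mulEquiv (AmbiguousClass.intAut
            (absRestrictNormalHom (fixedField (W.borelKernel C ⊓ κ.layerSubgroup n) :
              IntermediateField K (AlgebraicClosure K)) γ)) c)) = ((γ • m : W.geomTorsion (p : ℤ)) : _ ⧸ C)} ≤ B₂) :
    (fineSelmerInfty (↥(W.geomTorsion (p : ℤ))) κ :
      Set (subgroupH1 κ.kerSubgroup (W.geomTorsion (p : ℤ)))).Finite := by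
  have hpr : p.Prime := Fact.out
  haveI : NeZero p := ⟨hpr.ne_zero⟩
  -- the module `M = E[p]`
  haveI hfinM : Finite (W.geomTorsion (p : ℤ)) := W.finite_geomTorsion_nat (NeZero.ne p)
  have hpM : ∀ m : ↥(W.geomTorsion (p : ℤ)), p • m = 0 := fun m =>
    Subtype.ext (by
      rw [AddSubmonoidClass.coe_nsmul, ZeroMemClass.coe_zero]
      exact AddSubgroup.torsionBy.nsmul_iff.mp m.2)
  -- the Borel kernel `N`
  set N : Subgroup (absoluteGaloisGroup K) := W.borelKernel C with hNdef
  haveI hNn : N.Normal := borelKernel_normal hC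
  have hNopen : IsOpen (N : Set (absoluteGaloisGroup K)) := isOpen_borelKernel C
  -- the quotient module `Q = E[p]/C` with its `Γ_K`-action
  set M : Type := ↥(W.geomTorsion (p : ℤ)) with hMdef
  letI instQ : DistribMulAction (absoluteGaloisGroup K) (M ⧸ C) :=
    { smul := fun σ ↦ QuotientAddGroup.map C C (DistribSMul.toAddMonoidHom M σ)
        (fun x hx ↦ AddSubgroup.mem_comap.2 (hC σ x hx))
      one_smul := fun q ↦ QuotientAddGroup.induction_on q fun m ↦ by
        change QuotientAddGroup.map C C (DistribSMul.toAddMonoidHom M 1) _ (m : M ⧸ C) = _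
        rw [QuotientAddGroup.map_mk, DistribSMul.toAddMonoidHom_apply, one_smul]
      mul_smul := fun σ τ q ↦ QuotientAddGroup.induction_on q fun m ↦ by
        change QuotientAddGroup.map C C (DistribSMul.toAddMonoidHom M (σ * τ)) _ (m : M ⧸ C) =
          QuotientAddGroup.map C C (DistribSMul.toAddMonoidHom M σ) _
            (QuotientAddGroup.map C C (DistribSMul.toAddMonoidHom M τ) _ (m : M ⧸ C))
        rw [QuotientAddGroup.map_mk, QuotientAddGroup.map_mk, QuotientAddGroup.map_mk,
          DistribSMul.toAddMonoidHom_apply, DistribSMul.toAddMonoidHom_apply,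
          DistribSMul.toAddMonoidHom_apply, mul_smul]
      smul_zero := fun σ ↦ map_zero _
      smul_add := fun σ a b ↦ map_add _ a b }
  letI : TopologicalSpace (M ⧸ C) := ⊥
  haveI : DiscreteTopology (M ⧸ C) := ⟨rfl⟩
  have hsmulQ : ∀ (σ : absoluteGaloisGroup K) (m : M), σ • (m : M ⧸ C) = ((σ • m : M) : M ⧸ C) :=
    fun σ m ↦ rfl
  let π : M →+ M ⧸ C := QuotientAddGroup.mk' C
  have hπ : ∀ (σ : absoluteGaloisGroup K) (m : M), π (σ • m) = σ • π m := fun σ m ↦ rfl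
  have hπker : ∀ m : M, π m = 0 ↔ m ∈ C := fun m ↦ QuotientAddGroup.eq_zero_iff m
  have hNQ : ∀ σ ∈ N, ∀ q : M ⧸ C, σ • q = q := fun σ hσ q ↦
    QuotientAddGroup.induction_on q fun m ↦ by
      rw [hsmulQ, QuotientAddGroup.eq_iff_sub_mem]
      exact (mem_borelKernel_iff.1 hσ).2 m
  have hNC : ∀ σ ∈ N, ∀ m : M, π m = 0 → σ • m = m := fun σ hσ m hm ↦
    (mem_borelKernel_iff.1 hσ).1 m ((hπker m).1 hm)
  have hpQ : ∀ q : M ⧸ C, p • q = 0 := fun q ↦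
    QuotientAddGroup.induction_on q fun m ↦ by
      rw [← QuotientAddGroup.mk_nsmul, hpM, QuotientAddGroup.mk_zero]
  haveI : Finite (M ⧸ C) := inferInstance
  -- the submodule `C` with its `Γ_K`-action
  letI instC : DistribMulAction (absoluteGaloisGroup K) C :=
    { smul := fun σ c ↦ ⟨σ • (c : M), hC σ c c.2⟩
      one_smul := fun c ↦ Subtype.ext (one_smul _ (c : M))
      mul_smul := fun σ τ c ↦ Subtype.ext (mul_smul σ τ (c : M))
      smul_zero := fun σ ↦ Subtype.ext (smul_zero σ)
      smul_add := fun σ a b ↦ Subtype.ext (smul_add σ (a : M) (b : M)) }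
  haveI : DiscreteTopology C := inferInstance
  have hsmulC : ∀ (σ : absoluteGaloisGroup K) (c : C), ((σ • c : C) : M) = σ • (c : M) := fun σ c ↦ rfl
  have hNC' : ∀ σ ∈ N, ∀ c : C, σ • c = c := fun σ hσ c ↦
    Subtype.ext ((mem_borelKernel_iff.1 hσ).1 c c.2)
  have hpC : ∀ c : C, p • c = 0 := fun c ↦ Subtype.ext (by
    rw [AddSubmonoidClass.coe_nsmul, ZeroMemClass.coe_zero]; exact hpM (c : M))
  haveI : Finite C := inferInstance
  -- the finite set `S` of places above `p` and bad places; `E[p]` unramified outside `S`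
  have hSfin : ({v : HeightOneSpectrum (𝓞 K) | (p : 𝓞 K) ∈ v.asIdeal} ∪ W.badPlaces (𝓞 K)).Finite := by
    refine Set.Finite.union ?_ (W.finite_badPlaces_holds (𝓞 K))
    have hne : Ideal.span {(p : 𝓞 K)} ≠ 0 := by
      rw [Ideal.zero_eq_bot, Ne, Ideal.span_singleton_eq_bot]
      exact_mod_cast hpr.ne_zero
    refine (Ideal.finite_factors hne).subset fun v hv ↦ ?_
    simp only [Set.mem_setOf_eq] at hv ⊢
    exact Ideal.dvd_iff_le.mpr ((Ideal.span_singleton_le_iff_mem _).mpr hv)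
  have hunr : ∀ v ∉ ({v : HeightOneSpectrum (𝓞 K) | (p : 𝓞 K) ∈ v.asIdeal} ∪ W.badPlaces (𝓞 K)),
      ∀ 𝔓 ∈ v.primesAbove, ∀ σ ∈ 𝔓.inertia (absoluteGaloisGroup K), ∀ m : M, σ • m = m := by
    intro v hv 𝔓 h𝔓 σ hσ m
    rw [Set.mem_union, not_or, Set.mem_setOf_eq, mem_badPlaces_iff, not_not] at hv
    exact W.smul_geomTorsion_eq_of_mem_inertia hv.2 (n := (p : ℤ)) (by exact_mod_cast hv.1) h𝔓 hσ m
  -- the count hypotheses in the form the equivariant count consumes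
  have hcntQ' : ∀ n : ℕ,
      haveI : IsGalois K (fixedField (N ⊓ κ.layerSubgroup n) : IntermediateField K (AlgebraicClosure K)) :=
        isGalois_fixedField_inf_layerSubgroup κ N hNopen n
      Nat.card {μ : Additive (ClassGroup (𝓞 (fixedField (N ⊓ κ.layerSubgroup n) :
          IntermediateField K (AlgebraicClosure K)))) →+ (M ⧸ C) //
        ∀ γ ∈ κ.layerSubgroup n, ∀ c,
          μ (Additive.ofMul (ClassGroup.mulEquiv (AmbiguousClass.intAut
            (absRestrictNormalHom (fixedField (N ⊓ κ.layerSubgroup n) :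
              IntermediateField K (AlgebraicClosure K)) γ)) c)) = γ • μ (Additive.ofMul c)} ≤ B₂ := by
    intro n
    haveI : IsGalois K (fixedField (N ⊓ κ.layerSubgroup n) : IntermediateField K (AlgebraicClosure K)) :=
      isGalois_fixedField_inf_layerSubgroup κ N hNopen n
    refine le_trans (le_of_eq (Nat.card_congr (Equiv.subtypeEquivRight fun μ => ?_))) (hcntQ n)
    refine forall_congr' fun γ => forall_congr' fun _ => forall_congr' fun c => ?_
    constructor
    · intro h m hm
      rw [h, hm, hsmulQ]
    · intro h
      obtain ⟨m, hm⟩ := QuotientAddGroup.mk_surjective (μ (Additive.ofMul c))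
      rw [h m hm.symm, ← hm, hsmulQ]
  have hcntC' : ∀ n : ℕ,
      haveI : IsGalois K (fixedField (N ⊓ κ.layerSubgroup n) : IntermediateField K (AlgebraicClosure K)) :=
        isGalois_fixedField_inf_layerSubgroup κ N hNopen n
      Nat.card {μ : Additive (ClassGroup (𝓞 (fixedField (N ⊓ κ.layerSubgroup n) :
          IntermediateField K (AlgebraicClosure K)))) →+ C //
        ∀ γ ∈ κ.layerSubgroup n, ∀ c,
          μ (Additive.ofMul (ClassGroup.mulEquiv (AmbiguousClass.intAut
            (absRestrictNormalHom (fixedField (N ⊓ κ.layerSubgroup n) :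
              IntermediateField K (AlgebraicClosure K)) γ)) c)) = γ • μ (Additive.ofMul c)} ≤ B₁ := by
    intro n
    haveI : IsGalois K (fixedField (N ⊓ κ.layerSubgroup n) : IntermediateField K (AlgebraicClosure K)) :=
      isGalois_fixedField_inf_layerSubgroup κ N hNopen n
    refine le_trans (le_of_eq (Nat.card_congr (Equiv.subtypeEquivRight fun μ => ?_))) (hcntC n)
    refine forall_congr' fun γ => forall_congr' fun _ => forall_congr' fun c => ?_
    rw [← Subtype.coe_inj, hsmulC]
  -- (Q) EQUIVARIANT everywhere-unramified homs with values in `E[p]/C` are finite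
  have hQfin : {f ∈ unramifiedHoms (N ⊓ κ.kerSubgroup) (M ⧸ C) (∅ : Set (HeightOneSpectrum (𝓞 K))) |
      ∀ h ∈ κ.kerSubgroup, ∀ u u' : ↥(N ⊓ κ.kerSubgroup),
        (u' : absoluteGaloisGroup K) = h * u * h⁻¹ → f u' = h • f u}.Finite :=
    equivariantUnramifiedHoms_finite_of_card_le κ N hNopen hp (M ⧸ C) hNQ hpQ B₂ hcntQ'
  -- (C) EQUIVARIANT `C`-valued everywhere-unramified homs are finite
  have hCfin : {f ∈ unramifiedHoms (N ⊓ κ.kerSubgroup) M (∅ : Set (HeightOneSpectrum (𝓞 K))) |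
      (∀ u, π (f u) = 0) ∧ ∀ h ∈ κ.kerSubgroup, ∀ u u' : ↥(N ⊓ κ.kerSubgroup),
        (u' : absoluteGaloisGroup K) = h * u * h⁻¹ → f u' = h • f u}.Finite := by
    have h := equivariantUnramifiedHoms_finite_of_card_le κ N hNopen hp C hNC' hpC B₁ hcntC'
    -- every member is the image of an equivariant member of `Hom(U, C; ∅)`
    refine (h.image fun (f' : ↥(N ⊓ κ.kerSubgroup) → C) u ↦ (f' u : M)).subset ?_
    rintro f ⟨hf, hfπ, hfeq⟩
    have hfC : ∀ u, f u ∈ C := fun u ↦ (hπker _).1 (hfπ u)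
    refine ⟨fun u ↦ ⟨f u, hfC u⟩, ⟨⟨hf.1.subtype_mk _, fun σ τ ↦ Subtype.ext (hf.2.1 σ τ),
      fun v hv 𝔓 h𝔓 σ hσ ↦ Subtype.ext (hf.2.2 v hv 𝔓 h𝔓 σ hσ)⟩,
      fun h' hh' u u' hu' ↦ Subtype.ext (hfeq h' hh' u u' hu')⟩, rfl⟩
  -- equivariant dévissage
  exact finite_fineSelmerInfty_of_extension_equivariant κ hκ π hπ N hNopen hNQ hNC _ hSfin hunr hQfin hCfin

end Count

end Literature.NumberTheory.EllipticCurves.CoatesSujatha2005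

/-! ## §2 Door L6 per character: the layer-zero count lemmas (any number field with a prime totally ramified in `K_∞`) -/

namespace Literature.NumberTheory.EllipticCurves.CoatesSujatha2005.ReducibleLayerZero

open Literature.NumberTheory.IwasawaTheory Literature.NumberTheory.GaloisRepresentations
  Literature.NumberTheory.NumberFields Literature.NumberTheory.EllipticCurves
  Literature.NumberTheory.EllipticCurves.GreenbergSelmer Literature.NumberTheory.EllipticCurves.ZpExtension
  Literature.NumberTheory.IwasawaTheory.EquivariantUnramifiedHomsZpTowerFinite
  Literature.NumberTheory.IwasawaTheory.EquivariantHomLayerOfAbsolute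
  Literature.NumberTheory.EllipticCurves.FineSelmerReducibleIsotypic
-- `_root_`: some import closures declare `Literature.NumberTheory.EllipticCurves.WeierstrassCurve.*`
open _root_.WeierstrassCurve

variable {K : Type} [Field K] [NumberField K] (W : WeierstrassCurve K) [W.IsElliptic] {p : ℕ} [Fact p.Prime]

omit [NumberField K] in
/-- `p ∤ #Gal(K(χ₁,χ₂)/K)` for a stable line `C` (`[F : K] ∣ (p − 1)²`). [cite: Wuthrich2014, Lemma 14 (p. 396)] -/
theorem not_dvd_card_aut_borelField [CharZero K] (C : AddSubgroup (W.geomTorsion (p : ℤ)))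
    (hC : ∀ (σ : absoluteGaloisGroup K) (x : W.geomTorsion (p : ℤ)), x ∈ C → σ • x ∈ C)
    (h1 : C ≠ ⊥) (h2 : C ≠ ⊤) :
    haveI : NeZero p := ⟨(Fact.out : p.Prime).ne_zero⟩
    ¬ p ∣ Nat.card ((W.borelField C) ≃ₐ[K] (W.borelField C)) := by
  have hpr : p.Prime := Fact.out
  haveI : NeZero p := ⟨hpr.ne_zero⟩
  haveI : FiniteDimensional K (W.borelField C) := finiteDimensional_borelField C
  haveI : IsGalois K (W.borelField C) := isGalois_borelField hC
  rw [IsGalois.card_aut_eq_finrank]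
  intro h
  have h' := h.trans (W.finrank_borelField_dvd hC h1 h2)
  have h1' : p ∣ p - 1 := (Nat.Prime.dvd_mul hpr).mp (by simpa [sq] using h') |>.elim id id
  have h2' := Nat.le_of_dvd (Nat.sub_pos_of_lt hpr.one_lt) h1'
  have h3' := hpr.one_lt
  omega

/-- **Door L6 for the character `χ₁` of the line `C` (layer-zero count lemma).**  `E = W/K` elliptic over a number field
`K`, `p` odd, `C` a stable line, `F = K(χ₁,χ₂)` its Borel field, `κ` a `ℤ_p`-extension of `K` in which some prime of `K̄`
is totally ramified (`I_𝔓̄ · Gal(K̄/K_∞) = Γ_K`; automatic for `K = ℚ`, `κ` cyclotomic), `F_n = K̄^{borelKernel C ∩ κ⁻¹(pⁿℤ_p)}`.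
Data: a subfield `K₁ ⊆ F` and a generator `P ∈ C ∖ 0` fixed by `Γ_{K₁}` (`K₁ = K(P)`), such that (c2*)₁ every additive
`μ : Cl(𝓞_{K₁}) → ZMod p` with `μ([σ̄ I]) = a • μ([I])` whenever `τ|_{K₁} = σ̄` and `τ • P = a • P` is zero (no
`χ₁`-eigenline in `Cl(K₁) ⊗ 𝔽_p`), and (c3*)₁ no non-zero point of `C` is fixed by a decomposition group above `p`.  Then for
every `n` the `Gal(K̄/K_n)`-equivariant additive maps `Cl(𝓞_{F_n}) → C` number at most `1`.
[cite: DeoRaySujatha2023, §3 Thm. 3.8 (c2), (c3) and §5 Lemma 5.1] [cite: Washington1997, §13.3 Lemmas 13.14–13.16 and §10.1 Thm. 10.4 (proof)]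
[cite: Wuthrich2014, Lemma 14 (p. 396)] -/
theorem natCard_equivariantHom_line_layer_le_one (hp2 : p ≠ 2)
    (C : AddSubgroup (W.geomTorsion (p : ℤ)))
    (hC : ∀ (σ : absoluteGaloisGroup K) (x : W.geomTorsion (p : ℤ)), x ∈ C → σ • x ∈ C)
    (h1 : C ≠ ⊥) (h2 : C ≠ ⊤)
    (K₁ : IntermediateField K (W.borelField C)) [NumberField K₁]
    (P : W.geomTorsion (p : ℤ)) (hPC : P ∈ C) (hP0 : P ≠ 0)
    (hPK : haveI : NeZero p := ⟨(Fact.out : p.Prime).ne_zero⟩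
      haveI := isGalois_borelField (W := W) hC
      ∀ τ : absoluteGaloisGroup K,
        (∀ x : K₁, absRestrictNormalHom (W.borelField C) τ (x : W.borelField C) = x) → τ • P = P)
    (hEig : haveI : NeZero p := ⟨(Fact.out : p.Prime).ne_zero⟩
      haveI := isGalois_borelField (W := W) hC
      ∀ μ : Additive (ClassGroup (𝓞 K₁)) →+ ZMod p,
        (∀ (τ : absoluteGaloisGroup K) (σ : K₁ ≃ₐ[K] K₁) (a : ℕ),
          (∀ x : K₁, absRestrictNormalHom (W.borelField C) τ (x : W.borelField C) = ((σ x : K₁) : W.borelField C)) →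
          τ • P = a • P →
          ∀ (I J : (Ideal (𝓞 K₁))⁰),
            (J : Ideal (𝓞 K₁)) = (I : Ideal (𝓞 K₁)).map (AmbiguousClass.intAut σ : 𝓞 K₁ →+* 𝓞 K₁) →
            μ (Additive.ofMul (ClassGroup.mk0 J)) = a • μ (Additive.ofMul (ClassGroup.mk0 I))) →
        μ = 0)
    (hD : ∀ v : HeightOneSpectrum (𝓞 K), ((p : ℕ) : 𝓞 K) ∈ v.asIdeal →
      ∀ w : W.geomTorsion (p : ℤ), w ∈ C → (∀ d ∈ GreenbergSelmer.decomp v, d • w = w) → w = 0)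
    (κ : ZpExtension K p)
    (hram : ∃ 𝔓' : Ideal (absIntegers (𝓞 K) K), 𝔓'.IsMaximal ∧
      𝔓'.inertia (absoluteGaloisGroup K) ⊔ κ.kerSubgroup = ⊤)
    (n : ℕ) :
    haveI : (W.borelKernel C).Normal := borelKernel_normal hC
    haveI : NeZero p := ⟨(Fact.out : p.Prime).ne_zero⟩
    haveI := isGalois_fixedField_inf_layerSubgroup κ (W.borelKernel C) (isOpen_borelKernel C) n
    Nat.card {μ : Additive (ClassGroup (𝓞 (fixedField (W.borelKernel C ⊓ κ.layerSubgroup n) :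
        IntermediateField K (AlgebraicClosure K)))) →+ C //
      ∀ γ ∈ κ.layerSubgroup n, ∀ c,
        ((μ (Additive.ofMul (ClassGroup.mulEquiv (AmbiguousClass.intAut
          (absRestrictNormalHom (fixedField (W.borelKernel C ⊓ κ.layerSubgroup n) :
            IntermediateField K (AlgebraicClosure K)) γ)) c)) : C) : W.geomTorsion (p : ℤ)) =
          γ • ((μ (Additive.ofMul c) : C) : W.geomTorsion (p : ℤ))} ≤ 1 := by
  have hpr : p.Prime := Fact.out
  haveI : NeZero p := ⟨hpr.ne_zero⟩
  haveI hfinM : Finite (W.geomTorsion (p : ℤ)) := W.finite_geomTorsion_nat (NeZero.ne p)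
  have hV : Nat.card (W.geomTorsion (p : ℤ)) = p ^ 2 := W.natCard_geomTorsion_eq_sq_of_charZero hpr
  have hcardC : Nat.card C = p := card_eq_of_ne_bot_of_ne_top hV h1 h2
  have hpM : ∀ m : W.geomTorsion (p : ℤ), p • m = 0 := fun m =>
    Subtype.ext (by
      rw [AddSubmonoidClass.coe_nsmul, ZeroMemClass.coe_zero]
      exact AddSubgroup.torsionBy.nsmul_iff.mp m.2)
  -- the Borel kernel and field
  haveI hNn : (W.borelKernel C).Normal := borelKernel_normal hC
  have hNopen : IsOpen (W.borelKernel C : Set (absoluteGaloisGroup K)) := isOpen_borelKernel C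
  haveI : FiniteDimensional K (W.borelField C) := finiteDimensional_borelField C
  haveI hFgal : IsGalois K (W.borelField C) := isGalois_borelField hC
  haveI : NumberField (W.borelField C) := NumberField.of_module_finite K (W.borelField C)
  have hG : ¬ p ∣ Nat.card ((W.borelField C) ≃ₐ[K] (W.borelField C)) := not_dvd_card_aut_borelField W C hC h1 h2
  have hL₀ : ¬ p ∣ Module.finrank K (W.borelField C) := by rwa [← IsGalois.card_aut_eq_finrank]
  have hresN : ∀ τ : absoluteGaloisGroup K, absRestrictNormalHom (W.borelField C) τ = 1 ↔ τ ∈ W.borelKernel C := by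
    intro τ
    rw [absRestrictNormalHom_eq_one_iff, borelField_def]
    exact SetLike.ext_iff.mp (fixingSubgroup_fixedField_of_isOpen _ hNopen) τ
  -- the submodule `C` with its `Γ_K`-action
  letI instC : DistribMulAction (absoluteGaloisGroup K) C :=
    { smul := fun σ c ↦ ⟨σ • (c : W.geomTorsion (p : ℤ)), hC σ c c.2⟩
      one_smul := fun c ↦ Subtype.ext (one_smul _ (c : W.geomTorsion (p : ℤ)))
      mul_smul := fun σ τ c ↦ Subtype.ext (mul_smul σ τ (c : W.geomTorsion (p : ℤ)))
      smul_zero := fun σ ↦ Subtype.ext (smul_zero σ)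
      smul_add := fun σ a b ↦ Subtype.ext (smul_add σ (a : W.geomTorsion (p : ℤ)) (b : W.geomTorsion (p : ℤ))) }
  have hsmulC : ∀ (σ : absoluteGaloisGroup K) (c : C), ((σ • c : C) : W.geomTorsion (p : ℤ)) = σ • (c : W.geomTorsion (p : ℤ)) :=
    fun σ c ↦ rfl
  have hNC' : ∀ σ ∈ W.borelKernel C, ∀ c : C, σ • c = c := fun σ hσ c ↦
    Subtype.ext ((mem_borelKernel_iff.1 hσ).1 c c.2)
  have hpC : ∀ c : C, p • c = 0 := fun c ↦ Subtype.ext (by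
    rw [AddSubmonoidClass.coe_nsmul, ZeroMemClass.coe_zero]; exact hpM (c : W.geomTorsion (p : ℤ)))
  haveI : Finite C := inferInstance
  -- (c2*)₁ at the Borel field, from the eigen-test on `K₁` (conjA-anchor g13, `S = ∅`, `V = C` one-dimensional)
  have hirr : ∀ U : AddSubgroup C,
      (∀ τ : absoluteGaloisGroup K, ∀ v ∈ U, τ • v ∈ U) → U = ⊥ ∨ U = ⊤ := by
    intro U _
    haveI : Fact (Nat.card C).Prime := ⟨by rw [hcardC]; exact hpr⟩
    exact U.eq_bot_or_eq_top_of_prime_card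
  have h0F : ∀ f : Additive (ClassGroup (𝓞 (W.borelField C))) →+ C,
      (∀ (τ : absoluteGaloisGroup K) (c : ClassGroup (𝓞 (W.borelField C))),
        f (Additive.ofMul (ClassGroup.mulEquiv (AmbiguousClass.intAut (absRestrictNormalHom (W.borelField C) τ)) c)) =
          τ • f (Additive.ofMul c)) → f = 0 := by
    intro f hf
    refine DeoRaySujatha2023.equivariantHom_classGroup_eq_zero_of_eigenHom_subfield (W.borelField C) p hG
      (fun τ hτ v => hNC' τ ((hresN τ).mp hτ) v) hpC hirr K₁ ⟨P, hPC⟩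
      (fun h => hP0 (congrArg Subtype.val h)) (fun τ hτ => Subtype.ext (hPK τ hτ)) ∅ ?_ f
      ((EquivariantIwasawaLemma.equivariant_iff_forall_mk0 (absRestrictNormalHom (W.borelField C)) f).mp hf)
      (fun _ _ h => (Set.notMem_empty _ h).elim)
    intro μ hμ _
    refine hEig μ fun τ σ a hτσ hτP I J hIJ => hμ τ σ a hτσ ?_ I J hIJ
    exact Subtype.ext (by rw [hsmulC, AddSubmonoidClass.coe_nsmul]; exact hτP)
  -- door L6: `Γ_K`-equivariant vanishing on `Cl(F·K_m)` for every `m`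
  haveI hgal := fun m => κ.isGalois_layer_holds m
  haveI hfd := fun m => κ.finiteDimensional_layer_holds m
  haveI hNF : ∀ m, NumberField ↥(W.borelField C ⊔ κ.layer m) := fun m => NumberField.of_module_finite K _
  have hL6 : ∀ (m : ℕ) (f : Additive (ClassGroup (𝓞 ↥(W.borelField C ⊔ κ.layer m))) →+ C),
      (∀ (τ : absoluteGaloisGroup K) (c : ClassGroup (𝓞 ↥(W.borelField C ⊔ κ.layer m))),
        f (Additive.ofMul (ClassGroup.mulEquiv (AmbiguousClass.intAut
          (absRestrictNormalHom (W.borelField C ⊔ κ.layer m) τ)) c)) = τ • f (Additive.ofMul c)) → f = 0 :=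
    fun m f hf =>
    EquivariantIwasawaLemma.equivariantHom_classGroup_eq_zero_layer_compositum_tower_of_totallyRamified hp2 κ
      (W.borelField C) hL₀ hram hpC (fun τ hτ v => hNC' τ ((hresN τ).mp hτ) v) h0F
      (fun v hv w hw => Subtype.ext (hD v hv (w : W.geomTorsion (p : ℤ)) w.2 fun d hd => by rw [← hsmulC, hw d hd]))
      m f hf
  -- the `p`-group bridge at `F ⊔ K_n`, transported to `K̄^{N ∩ κ⁻¹(pⁿℤ_p)} = F ⊔ K_n`
  have key : ∀ (E₂ : IntermediateField K (AlgebraicClosure K))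
      (hE : E₂ = (fixedField (W.borelKernel C ⊓ κ.layerSubgroup n) : IntermediateField K (AlgebraicClosure K)))
      [IsGalois K E₂] [NumberField E₂],
      (∀ f : Additive (ClassGroup (𝓞 ↥E₂)) →+ C,
        (∀ (τ : absoluteGaloisGroup K) (c : ClassGroup (𝓞 ↥E₂)),
          f (Additive.ofMul (ClassGroup.mulEquiv (AmbiguousClass.intAut (absRestrictNormalHom E₂ τ)) c)) =
            τ • f (Additive.ofMul c)) → f = 0) →
      haveI := isGalois_fixedField_inf_layerSubgroup κ (W.borelKernel C) hNopen n
      Nat.card {μ : Additive (ClassGroup (𝓞 (fixedField (W.borelKernel C ⊓ κ.layerSubgroup n) :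
          IntermediateField K (AlgebraicClosure K)))) →+ C //
        ∀ γ ∈ κ.layerSubgroup n, ∀ c,
          ((μ (Additive.ofMul (ClassGroup.mulEquiv (AmbiguousClass.intAut
            (absRestrictNormalHom (fixedField (W.borelKernel C ⊓ κ.layerSubgroup n) :
              IntermediateField K (AlgebraicClosure K)) γ)) c)) : C) : W.geomTorsion (p : ℤ)) =
            γ • ((μ (Additive.ofMul c) : C) : W.geomTorsion (p : ℤ))} ≤ 1 := by
    intro E₂ hE _ _ h0
    subst hE
    refine le_of_eq ((Nat.card_congr (Equiv.subtypeEquivRight fun μ => ?_)).trans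
      (natCard_equivariantHom_layerSubgroup_eq_one_of_forall_eq_zero κ _ hpC h0 n))
    refine forall_congr' fun γ => forall_congr' fun _ => forall_congr' fun c => ?_
    exact ⟨fun h => Subtype.ext (by rw [hsmulC]; exact h), fun h => by rw [← hsmulC]; exact congrArg Subtype.val h⟩
  have hfield : (W.borelField C ⊔ κ.layer n) =
      (fixedField (W.borelKernel C ⊓ κ.layerSubgroup n) : IntermediateField K (AlgebraicClosure K)) := by
    rw [borelField_def]
    exact (FineSelmerStabilizerDescent.fixedField_inf_layerSubgroup_eq_fixedField_sup_layer κ _ hNopen n).symm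
  exact key (W.borelField C ⊔ κ.layer n) hfield (hL6 n)

/-- **Door L6 for the character `χ₂` of `E[p]/C` (layer-zero count lemma).**  Setting of
`natCard_equivariantHom_line_layer_le_one`.  Data: a subfield `K₂ ⊆ F = K(χ₁,χ₂)` and a point `P₂ ∈ E[p] ∖ C` whose class
generates `E[p]/C` and is fixed by `Γ_{K₂}` modulo `C` (`K₂ = K(P′)`, the field of the kernel of the dual isogeny), such that
(c2*)₂ every additive `μ : Cl(𝓞_{K₂}) → ZMod p` with `μ([σ̄ I]) = a • μ([I])` whenever `τ|_{K₂} = σ̄` and `τ • P₂ ≡ a • P₂ (mod C)`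
is zero (no `χ₂`-eigenline in `Cl(K₂) ⊗ 𝔽_p`), and (c3*)₂ a point of `E[p]` fixed modulo `C` by a decomposition group above `p`
lies in `C` (`(E[p]/C)^{D_v} = 0`).  Then for every `n` the additive maps `μ : Cl(𝓞_{F_n}) → E[p]/C` with `μ(γ|·c) = γ•m mod C`
whenever `μ(c) = m mod C` (`γ ∈ Gal(K̄/K_n)`) number at most `1`.
[cite: DeoRaySujatha2023, §3 Thm. 3.8 (c2), (c3) and §5 Lemma 5.1] [cite: Washington1997, §13.3 Lemmas 13.14–13.16 and §10.1 Thm. 10.4 (proof)]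
[cite: Wuthrich2014, Lemma 14 (p. 396)] -/
theorem natCard_equivariantHom_quotient_layer_le_one (hp2 : p ≠ 2)
    (C : AddSubgroup (W.geomTorsion (p : ℤ)))
    (hC : ∀ (σ : absoluteGaloisGroup K) (x : W.geomTorsion (p : ℤ)), x ∈ C → σ • x ∈ C)
    (h1 : C ≠ ⊥) (h2 : C ≠ ⊤)
    (K₂ : IntermediateField K (W.borelField C)) [NumberField K₂]
    (P₂ : W.geomTorsion (p : ℤ)) (hP₂ : P₂ ∉ C)
    (hPK : haveI : NeZero p := ⟨(Fact.out : p.Prime).ne_zero⟩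
      haveI := isGalois_borelField (W := W) hC
      ∀ τ : absoluteGaloisGroup K,
        (∀ x : K₂, absRestrictNormalHom (W.borelField C) τ (x : W.borelField C) = x) → τ • P₂ - P₂ ∈ C)
    (hEig : haveI : NeZero p := ⟨(Fact.out : p.Prime).ne_zero⟩
      haveI := isGalois_borelField (W := W) hC
      ∀ μ : Additive (ClassGroup (𝓞 K₂)) →+ ZMod p,
        (∀ (τ : absoluteGaloisGroup K) (σ : K₂ ≃ₐ[K] K₂) (a : ℕ),
          (∀ x : K₂, absRestrictNormalHom (W.borelField C) τ (x : W.borelField C) = ((σ x : K₂) : W.borelField C)) →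
          τ • P₂ - a • P₂ ∈ C →
          ∀ (I J : (Ideal (𝓞 K₂))⁰),
            (J : Ideal (𝓞 K₂)) = (I : Ideal (𝓞 K₂)).map (AmbiguousClass.intAut σ : 𝓞 K₂ →+* 𝓞 K₂) →
            μ (Additive.ofMul (ClassGroup.mk0 J)) = a • μ (Additive.ofMul (ClassGroup.mk0 I))) →
        μ = 0)
    (hD : ∀ v : HeightOneSpectrum (𝓞 K), ((p : ℕ) : 𝓞 K) ∈ v.asIdeal →
      ∀ m : W.geomTorsion (p : ℤ), (∀ d ∈ GreenbergSelmer.decomp v, d • m - m ∈ C) → m ∈ C)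
    (κ : ZpExtension K p)
    (hram : ∃ 𝔓' : Ideal (absIntegers (𝓞 K) K), 𝔓'.IsMaximal ∧
      𝔓'.inertia (absoluteGaloisGroup K) ⊔ κ.kerSubgroup = ⊤)
    (n : ℕ) :
    haveI : (W.borelKernel C).Normal := borelKernel_normal hC
    haveI : NeZero p := ⟨(Fact.out : p.Prime).ne_zero⟩
    haveI := isGalois_fixedField_inf_layerSubgroup κ (W.borelKernel C) (isOpen_borelKernel C) n
    Nat.card {μ : Additive (ClassGroup (𝓞 (fixedField (W.borelKernel C ⊓ κ.layerSubgroup n) :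
        IntermediateField K (AlgebraicClosure K)))) →+ (↥(W.geomTorsion (p : ℤ)) ⧸ C) //
      ∀ γ ∈ κ.layerSubgroup n, ∀ c, ∀ m : W.geomTorsion (p : ℤ), μ (Additive.ofMul c) = (m : ↥(W.geomTorsion (p : ℤ)) ⧸ C) →
        μ (Additive.ofMul (ClassGroup.mulEquiv (AmbiguousClass.intAut
          (absRestrictNormalHom (fixedField (W.borelKernel C ⊓ κ.layerSubgroup n) :
            IntermediateField K (AlgebraicClosure K)) γ)) c)) = ((γ • m : W.geomTorsion (p : ℤ)) : _ ⧸ C)} ≤ 1 := by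
  have hpr : p.Prime := Fact.out
  haveI : NeZero p := ⟨hpr.ne_zero⟩
  haveI hfinM : Finite (W.geomTorsion (p : ℤ)) := W.finite_geomTorsion_nat (NeZero.ne p)
  have hV : Nat.card (W.geomTorsion (p : ℤ)) = p ^ 2 := W.natCard_geomTorsion_eq_sq_of_charZero hpr
  have hcardC : Nat.card C = p := card_eq_of_ne_bot_of_ne_top hV h1 h2
  have hpM : ∀ m : W.geomTorsion (p : ℤ), p • m = 0 := fun m =>
    Subtype.ext (by
      rw [AddSubmonoidClass.coe_nsmul, ZeroMemClass.coe_zero]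
      exact AddSubgroup.torsionBy.nsmul_iff.mp m.2)
  -- the Borel kernel and field
  haveI hNn : (W.borelKernel C).Normal := borelKernel_normal hC
  have hNopen : IsOpen (W.borelKernel C : Set (absoluteGaloisGroup K)) := isOpen_borelKernel C
  haveI : FiniteDimensional K (W.borelField C) := finiteDimensional_borelField C
  haveI hFgal : IsGalois K (W.borelField C) := isGalois_borelField hC
  haveI : NumberField (W.borelField C) := NumberField.of_module_finite K (W.borelField C)
  have hG : ¬ p ∣ Nat.card ((W.borelField C) ≃ₐ[K] (W.borelField C)) := not_dvd_card_aut_borelField W C hC h1 h2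
  have hL₀ : ¬ p ∣ Module.finrank K (W.borelField C) := by rwa [← IsGalois.card_aut_eq_finrank]
  have hresN : ∀ τ : absoluteGaloisGroup K, absRestrictNormalHom (W.borelField C) τ = 1 ↔ τ ∈ W.borelKernel C := by
    intro τ
    rw [absRestrictNormalHom_eq_one_iff, borelField_def]
    exact SetLike.ext_iff.mp (fixingSubgroup_fixedField_of_isOpen _ hNopen) τ
  -- the quotient module `Q = E[p]/C` with its `Γ_K`-action
  letI instQ : DistribMulAction (absoluteGaloisGroup K) (↥(W.geomTorsion (p : ℤ)) ⧸ C) :=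
    { smul := fun σ ↦ QuotientAddGroup.map C C (DistribSMul.toAddMonoidHom (W.geomTorsion (p : ℤ)) σ)
        (fun x hx ↦ AddSubgroup.mem_comap.2 (hC σ x hx))
      one_smul := fun q ↦ QuotientAddGroup.induction_on q fun m ↦ by
        change QuotientAddGroup.map C C (DistribSMul.toAddMonoidHom _ 1) _ (m : _ ⧸ C) = _
        rw [QuotientAddGroup.map_mk, DistribSMul.toAddMonoidHom_apply, one_smul]
      mul_smul := fun σ τ q ↦ QuotientAddGroup.induction_on q fun m ↦ by
        change QuotientAddGroup.map C C (DistribSMul.toAddMonoidHom _ (σ * τ)) _ (m : _ ⧸ C) =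
          QuotientAddGroup.map C C (DistribSMul.toAddMonoidHom _ σ) _
            (QuotientAddGroup.map C C (DistribSMul.toAddMonoidHom _ τ) _ (m : _ ⧸ C))
        rw [QuotientAddGroup.map_mk, QuotientAddGroup.map_mk, QuotientAddGroup.map_mk,
          DistribSMul.toAddMonoidHom_apply, DistribSMul.toAddMonoidHom_apply,
          DistribSMul.toAddMonoidHom_apply, mul_smul]
      smul_zero := fun σ ↦ map_zero _
      smul_add := fun σ a b ↦ map_add _ a b }
  have hsmulQ : ∀ (σ : absoluteGaloisGroup K) (m : W.geomTorsion (p : ℤ)),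
      σ • (m : ↥(W.geomTorsion (p : ℤ)) ⧸ C) = ((σ • m : W.geomTorsion (p : ℤ)) : _ ⧸ C) := fun σ m ↦ rfl
  have hNQ : ∀ σ ∈ W.borelKernel C, ∀ q : ↥(W.geomTorsion (p : ℤ)) ⧸ C, σ • q = q := fun σ hσ q ↦
    QuotientAddGroup.induction_on q fun m ↦ by
      rw [hsmulQ, QuotientAddGroup.eq_iff_sub_mem]
      exact (mem_borelKernel_iff.1 hσ).2 m
  have hpQ : ∀ q : ↥(W.geomTorsion (p : ℤ)) ⧸ C, p • q = 0 := fun q ↦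
    QuotientAddGroup.induction_on q fun m ↦ by
      rw [← QuotientAddGroup.mk_nsmul, hpM, QuotientAddGroup.mk_zero]
  haveI : Finite (↥(W.geomTorsion (p : ℤ)) ⧸ C) := inferInstance
  have hcardQ : Nat.card (↥(W.geomTorsion (p : ℤ)) ⧸ C) = p := by
    have h := AddSubgroup.card_eq_card_quotient_mul_card_addSubgroup C
    rw [hV, hcardC, sq] at h
    exact (Nat.eq_of_mul_eq_mul_right hpr.pos h).symm
  -- (c2*)₂ at the Borel field, from the eigen-test on `K₂` (`V = E[p]/C` one-dimensional, `P = P₂ mod C`)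
  have hirr : ∀ U : AddSubgroup (↥(W.geomTorsion (p : ℤ)) ⧸ C),
      (∀ τ : absoluteGaloisGroup K, ∀ v ∈ U, τ • v ∈ U) → U = ⊥ ∨ U = ⊤ := by
    intro U _
    haveI : Fact (Nat.card (↥(W.geomTorsion (p : ℤ)) ⧸ C)).Prime := ⟨by rw [hcardQ]; exact hpr⟩
    exact U.eq_bot_or_eq_top_of_prime_card
  have hP0 : ((P₂ : W.geomTorsion (p : ℤ)) : ↥(W.geomTorsion (p : ℤ)) ⧸ C) ≠ 0 := fun h =>
    hP₂ ((QuotientAddGroup.eq_zero_iff P₂).mp h)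
  have h0F : ∀ f : Additive (ClassGroup (𝓞 (W.borelField C))) →+ (↥(W.geomTorsion (p : ℤ)) ⧸ C),
      (∀ (τ : absoluteGaloisGroup K) (c : ClassGroup (𝓞 (W.borelField C))),
        f (Additive.ofMul (ClassGroup.mulEquiv (AmbiguousClass.intAut (absRestrictNormalHom (W.borelField C) τ)) c)) =
          τ • f (Additive.ofMul c)) → f = 0 := by
    intro f hf
    refine DeoRaySujatha2023.equivariantHom_classGroup_eq_zero_of_eigenHom_subfield (W.borelField C) p hG
      (fun τ hτ v => hNQ τ ((hresN τ).mp hτ) v) hpQ hirr K₂ (P₂ : ↥(W.geomTorsion (p : ℤ)) ⧸ C) hP0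
      (fun τ hτ => by rw [hsmulQ, QuotientAddGroup.eq_iff_sub_mem]; exact hPK τ hτ) ∅ ?_ f
      ((EquivariantIwasawaLemma.equivariant_iff_forall_mk0 (absRestrictNormalHom (W.borelField C)) f).mp hf)
      (fun _ _ h => (Set.notMem_empty _ h).elim)
    intro μ hμ _
    refine hEig μ fun τ σ a hτσ hτP I J hIJ => hμ τ σ a hτσ ?_ I J hIJ
    rw [hsmulQ, ← QuotientAddGroup.mk_nsmul, QuotientAddGroup.eq_iff_sub_mem]
    exact hτP
  -- door L6: `Γ_K`-equivariant vanishing on `Cl(F·K_m)` for every `m`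
  haveI hgal := fun m => κ.isGalois_layer_holds m
  haveI hfd := fun m => κ.finiteDimensional_layer_holds m
  haveI hNF : ∀ m, NumberField ↥(W.borelField C ⊔ κ.layer m) := fun m => NumberField.of_module_finite K _
  have hL6 : ∀ (m : ℕ) (f : Additive (ClassGroup (𝓞 ↥(W.borelField C ⊔ κ.layer m))) →+ (↥(W.geomTorsion (p : ℤ)) ⧸ C)),
      (∀ (τ : absoluteGaloisGroup K) (c : ClassGroup (𝓞 ↥(W.borelField C ⊔ κ.layer m))),
        f (Additive.ofMul (ClassGroup.mulEquiv (AmbiguousClass.intAut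
          (absRestrictNormalHom (W.borelField C ⊔ κ.layer m) τ)) c)) = τ • f (Additive.ofMul c)) → f = 0 :=
    fun m f hf =>
    EquivariantIwasawaLemma.equivariantHom_classGroup_eq_zero_layer_compositum_tower_of_totallyRamified hp2 κ
      (W.borelField C) hL₀ hram hpQ (fun τ hτ v => hNQ τ ((hresN τ).mp hτ) v) h0F
      (fun v hv q hq => by
        induction q using QuotientAddGroup.induction_on with
        | H m =>
          exact (QuotientAddGroup.eq_zero_iff m).mpr (hD v hv m fun d hd =>
            (QuotientAddGroup.eq_iff_sub_mem).mp (by rw [← hsmulQ]; exact hq d hd)))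
      m f hf
  -- the `p`-group bridge at `F ⊔ K_n`, transported to `K̄^{N ∩ κ⁻¹(pⁿℤ_p)} = F ⊔ K_n`
  have key : ∀ (E₂ : IntermediateField K (AlgebraicClosure K))
      (hE : E₂ = (fixedField (W.borelKernel C ⊓ κ.layerSubgroup n) : IntermediateField K (AlgebraicClosure K)))
      [IsGalois K E₂] [NumberField E₂],
      (∀ f : Additive (ClassGroup (𝓞 ↥E₂)) →+ (↥(W.geomTorsion (p : ℤ)) ⧸ C),
        (∀ (τ : absoluteGaloisGroup K) (c : ClassGroup (𝓞 ↥E₂)),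
          f (Additive.ofMul (ClassGroup.mulEquiv (AmbiguousClass.intAut (absRestrictNormalHom E₂ τ)) c)) =
            τ • f (Additive.ofMul c)) → f = 0) →
      haveI := isGalois_fixedField_inf_layerSubgroup κ (W.borelKernel C) hNopen n
      Nat.card {μ : Additive (ClassGroup (𝓞 (fixedField (W.borelKernel C ⊓ κ.layerSubgroup n) :
          IntermediateField K (AlgebraicClosure K)))) →+ (↥(W.geomTorsion (p : ℤ)) ⧸ C) //
        ∀ γ ∈ κ.layerSubgroup n, ∀ c, ∀ m : W.geomTorsion (p : ℤ),
          μ (Additive.ofMul c) = (m : ↥(W.geomTorsion (p : ℤ)) ⧸ C) →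
          μ (Additive.ofMul (ClassGroup.mulEquiv (AmbiguousClass.intAut
            (absRestrictNormalHom (fixedField (W.borelKernel C ⊓ κ.layerSubgroup n) :
              IntermediateField K (AlgebraicClosure K)) γ)) c)) = ((γ • m : W.geomTorsion (p : ℤ)) : _ ⧸ C)} ≤ 1 := by
    intro E₂ hE _ _ h0
    subst hE
    refine le_of_eq ((Nat.card_congr (Equiv.subtypeEquivRight fun μ => ?_)).trans
      (natCard_equivariantHom_layerSubgroup_eq_one_of_forall_eq_zero κ _ hpQ h0 n))
    refine forall_congr' fun γ => forall_congr' fun _ => forall_congr' fun c => ?_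
    constructor
    · intro h
      obtain ⟨m, hm⟩ := QuotientAddGroup.mk_surjective (μ (Additive.ofMul c))
      rw [h m hm.symm, ← hm, hsmulQ]
    · intro h m hm
      rw [h, hm, hsmulQ]
  have hfield : (W.borelField C ⊔ κ.layer n) =
      (fixedField (W.borelKernel C ⊓ κ.layerSubgroup n) : IntermediateField K (AlgebraicClosure K)) := by
    rw [borelField_def]
    exact (FineSelmerStabilizerDescent.fixedField_inf_layerSubgroup_eq_fixedField_sup_layer κ _ hNopen n).symm
  exact key (W.borelField C ⊔ κ.layer n) hfield (hL6 n)

end Literature.NumberTheory.EllipticCurves.CoatesSujatha2005.ReducibleLayerZero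

end
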